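import Summits.HodgeConjecture.HodgeConjecture.Theorems.H413FinCoeffPureTensorOmega
import Summits.HodgeConjecture.HodgeConjecture.Theorems.H413FinAdelicPureTensorIntegrable
import Literature.NumberTheory.Li1992.RallisLocalFactorRowsPureTensor
import Literature.NumberTheory.Automorphic.SchwartzBruhatCoeffIntegrableOfSpan
import Literature.NumberTheory.Automorphic.AdelicSecondCountable
import HarnessLib

/-!
# H413 ∕ E-2 road C (`StubSW2` (ii)) — the finite Fourier coefficients `b ↦ ⟨Ω(1 ⊗ b)Φ_f, Ψ_f⟩` are INTEGRABLE over `U(J₁)(𝔸_{F,f})`,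
# for ALL `Φ_f, Ψ_f ∈ 𝒮(𝔸_{F,f}ⁿ)` (no displayed row left)

Crux H413 (stmt-HodgeConjecture-24833), FLOOR 0, programme P4, engine E-2 child line `F0_E2SiegelWeilWeilRange`, conjunct (ii) of `StubSW2`
(road C of the cell bus: lattice sum ≤ integral; the `hF` binder of ★ `Theorems/H413E2SW2OrbitalSumsReduction.orbitalSums_bounded_of_finIntegrable`
asks for the INTEGRABILITY over `U(J_W)(𝔸_{F,f})` of the finite matrix coefficients `b ↦ ⟨ω_f(b)Φ_f, Ψ_f⟩`).  For the place-assembled Weil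
representation `Ω = ⊗'_v ω_v` of a restricted family `𝓢` of local splittings of `U(J_V ⊗ J₁)(F_v)` (`J₁` a hermitian LINE with `(J₁.map c)ᵀ = J₁`,
big rank `n = N·1 ≥ 3`, `ω_v` `L²(μ'_vⁿ)`-isometric) this file proves it, in three steps:

* §1 **`integrable_finCoeff_of_localFactors`** — with EXACTLY the binders of ★ `Theorems/H413FinCoeffNonvanishing` (pure tensors `Φ_f = ⊗Φ_v`,
  `Ψ_f = ⊗Ψ_v` unramified off `T`, `ωfin u = Ω(1 ⊗ u)`, a continuous weight `w` trivial on the box of level `T`, the NAMED local factors `fl_v`, local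
  Haar measures `ν^W_v` of volume one off `S₀ ∋ i₀`): IF every `fl_v` is `ν^W_v`-integrable and the partial products of `∫ ‖fl_v‖` over `S ⊇ S₀ ∪ T`
  are bounded, THEN `b ↦ (∫ (ωfin(b)Φ_f) conj(Ψ_f) dμ) · w(b)` is `μ_f`-integrable — (F2) ★ `finCoeff_isPureTensor_of_Omega_line`, ★
  `continuous_finCoeff_of_Omega` and the restricted-product INTEGRABILITY exchange ★ `integrable_finAdelic_of_pureTensor` ([TateThesis1967, Thm 3.3.1]);
  `integrable_norm_finCoeff_of_localFactors` — the `‖·‖` spelling;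
* §2 **`integrable_finCoeff_mul_conj_chi_of_pureTensor`** ∕ **`integrable_finCoeff_of_pureTensor`** — the two rows DISCHARGED for ARBITRARY pure
  tensors (★ `Li1992/RallisLocalFactorRowsPureTensor.localFactor_rows_of_pureTensor`: every local factor integrable — ★
  `FinLocalSplittings.integrable_localCoeff`, split places by the Darboux∕coset bound, non-split places by compactness; bounded `L¹` partial
  products — ★ `eventually_localFactor_unitVec_normalised_bounds` and `Σ_v N(v)^{-n/2} < ∞`), the weight `w = conj ∘ χ₁ ∘ det⁻¹` box-trivial at some
  level (★ `exists_forall_boxSubgroup_eq_one`; local components `conj χ_{1,v}` BY `rfl`) and the unramified clause of `𝓢`;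
* §2 **`integrable_finCoeff_of_localSplittings`** — ALL `Φ_f, Ψ_f ∈ 𝒮(𝔸_{F,f}ⁿ)`: the pure tensors span (★ `span_range_piProdSB`) and the
  coefficient is sesquilinear (★ `SchwartzBruhat.integrable_coeff_of_span`) — «the general case follows from the factorizable one by linearity»
  ([Li1992, Thm 2.1 (26)–(27)]); + `‖·‖` forms.

What remains of `hF` for the CM family is the carrier bridge `R_e ω_f^{s}(1,b) R_e⁻¹ = w(b) • Ω(1 ⊗ b)` (★ `Theorems/H413FinPairRepVsOmega`) — see
`Theorems/H413E2SW2HFinOfCM`.  KERNEL: theorems only, DEF-FREE, no `sorry`; `--supports stmt-HodgeConjecture-24833 --as helper`.  HC_CM is proved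
only modulo the printed citations until rung 0 closes; this file proves nothing printed.

[cite: Li1992, Thm 2.1 (26)–(27) p. 184; §5 p. 206] [cite: TateThesis1967, Thm 3.3.1]
-/

set_option autoImplicit false
set_option linter.dupNamespace false

noncomputable section

open scoped RestrictedProduct ENNReal NNReal ComplexConjugate Matrix Kronecker Classical
open MeasureTheory NumberField IsDedekindDomain Filter Function Set Topology
open Literature.NumberTheory.Automorphic Literature.NumberTheory.Automorphic.UnitaryGroup
open Literature.NumberTheory.GelbartRogawski1991.UnitaryDualPair.LocalSplitting
open HodgeCM.PerL34 HodgeCM.PerL34.RestrictedMeasure HodgeCM.PerL34.PureTensor HodgeCM.PerL34.NoSmallSubgroups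

namespace Summit.HodgeConjecture.HodgeConjecture.Cruxes.H413.ThetaNonvanishing

/-! ## §1 From the local rows (pure tensors, named factors) -/

section Line

variable (F E : Type) [Field F] [NumberField F] [Field E] [NumberField E] [Algebra F E]
  [Algebra.IsQuadraticExtension F E] (c : E ≃ₐ[F] E) (N : ℕ) {n : ℕ} (e : Fin N × Fin 1 ≃ Fin n)
  (JV : Matrix (Fin N) (Fin N) E) (J₁ : Matrix (Fin 1) (Fin 1) E) (hJ₁ : J₁ 0 0 ≠ 0)
  {δ : E} (hcδ : c δ = -δ) (hδ : δ ≠ 0) {d : F} (hd : δ * δ = algebraMap F E d)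
  (Tb : Matrix (Fin n) (Fin n) F) (hTb : Tb.IsSymm) (hJb : Matrix.reindex e e (JV ⊗ₖ J₁) = Tb.map (algebraMap F E))
  (𝓢 : FinLocalSplittings F E c n hcδ hδ hd Tb hTb hJb)
  (ωfin : finAdelic F E c 1 J₁ → ↥(SchwartzBruhat (Fin n → FiniteAdeleRing (𝓞 F) F)) →
    ↥(SchwartzBruhat (Fin n → FiniteAdeleRing (𝓞 F) F)))
  (hωΩ : ∀ u f, ωfin u f = 𝓢.Omega (finPairEmb F E c N 1 e JV J₁ (1, u)) f)
  (w : finAdelic F E c 1 J₁ →* ℂ) (hwc : Continuous w) (T : Finset (HeightOneSpectrum (𝓞 F)))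
  (hw : ∀ k ∈ RestrictedProduct.boxSubgroup (fun v => localInt E c 1 J₁ v) T, w ((finAdelicEquiv F E c 1 J₁).symm k) = 1)
  (hρT : ∀ v ∉ T, unitVec F (Fin n) v ∈
    (𝓢.omegaLoc v).fixedPoints (localInt E c n (Matrix.reindex e e (JV ⊗ₖ J₁)) v))
  [MeasurableSpace (FiniteAdeleRing (𝓞 F) F)] [BorelSpace (FiniteAdeleRing (𝓞 F) F)]
  [∀ v : HeightOneSpectrum (𝓞 F), MeasurableSpace (v.adicCompletion F)]
  [∀ v : HeightOneSpectrum (𝓞 F), BorelSpace (v.adicCompletion F)]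
  (μ : Measure (Fin n → FiniteAdeleRing (𝓞 F) F)) [μ.IsAddHaarMeasure]
  (ν : ∀ v : HeightOneSpectrum (𝓞 F), Measure (Fin n → v.adicCompletion F)) [∀ v, (ν v).IsAddHaarMeasure]
  (Φ Ψ : LocalSBFamily F (Fin n)) (hΦ : ∀ v ∉ T, Φ v = unitVec F (Fin n) v) (hΨ : ∀ v ∉ T, Ψ v = unitVec F (Fin n) v)
  -- the (F3) data on `U(J₁)`
  [∀ v : HeightOneSpectrum (𝓞 F), MeasurableSpace (localPi E c 1 J₁ v)]
  [∀ v : HeightOneSpectrum (𝓞 F), BorelSpace (localPi E c 1 J₁ v)]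
  [MeasurableSpace (finAdelic F E c 1 J₁)] [BorelSpace (finAdelic F E c 1 J₁)]
  (μf : Measure (finAdelic F E c 1 J₁)) [μf.IsHaarMeasure]
  (νW : ∀ v : HeightOneSpectrum (𝓞 F), Measure (localPi E c 1 J₁ v)) [∀ v, (νW v).IsHaarMeasure] [∀ v, SigmaFinite (νW v)]
  (S₀ : Finset (HeightOneSpectrum (𝓞 F))) {i₀ : HeightOneSpectrum (𝓞 F)} (hi₀ : i₀ ∈ S₀) (hi₀T : i₀ ∈ T)
  (hB1 : ∀ v, v ∉ S₀ → νW v (localInt E c 1 J₁ v : Set (localPi E c 1 J₁ v)) = 1)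
  -- the named local factors
  (fl : ∀ v : HeightOneSpectrum (𝓞 F), localPi E c 1 J₁ v → ℂ)
  (hfl_def : fl = fun (v : HeightOneSpectrum (𝓞 F)) (g : localPi E c 1 J₁ v) =>
    (((ν v (integralBox F (Fin n) v)).toReal⁻¹ •
      ∫ z, ((𝓢.omegaLoc v (localCenter E c n (Matrix.reindex e e (JV ⊗ₖ J₁)) J₁ hJ₁ v g) (Φ v) :
          ↥(SchwartzBruhat (Fin n → v.adicCompletion F))) : (Fin n → v.adicCompletion F) → ℂ) z *
        conj (((Ψ v : ↥(SchwartzBruhat (Fin n → v.adicCompletion F))) :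
          (Fin n → v.adicCompletion F) → ℂ) z) ∂ν v) *
      w ((finAdelicEquiv F E c 1 J₁).symm (RestrictedProduct.mulSingle (fun v => localInt E c 1 J₁ v) v g))))

include hωΩ hwc hw hρT hΦ hΨ hi₀ hi₀T hB1 hfl_def in
/-- **(FIN-INTEGRABLE) from the local rows.**  With the binders of ★ `integral_finCoeff_ne_zero_of_localFactors`: IF every named local factor `fl_v`
is `ν^W_v`-integrable and the partial products of `∫ ‖fl_v‖` over `S ⊇ S₀ ∪ T` are bounded, THEN the finite Fourier coefficient
`b ↦ (∫ (ωfin(b)Φ_f) conj(Ψ_f) dμ) · w(b)` is INTEGRABLE over `U(J₁)(𝔸_{F,f})` for the Haar measure `μ_f` (★ (F2) pure-tensor structure, ★ continuity,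
★ restricted-product integrability exchange). [cite: Li1992, Thm 2.1 (27) p. 184] [cite: TateThesis1967, Thm 3.3.1] -/
theorem integrable_finCoeff_of_localFactors
    (hfl : ∀ v, Integrable (fl v) (νW v))
    (hB : ∃ B : ℝ, ∀ S : Finset (HeightOneSpectrum (𝓞 F)), S₀ ⊆ S → T ⊆ S →
      ∏ v ∈ S, ∫ x, ‖fl v x‖ ∂νW v ≤ B) :
    Integrable (fun b : finAdelic F E c 1 J₁ =>
      (∫ y, ((ωfin b (piProdSB F (Fin n) Φ) : ↥(SchwartzBruhat (Fin n → FiniteAdeleRing (𝓞 F) F))) :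
          (Fin n → FiniteAdeleRing (𝓞 F) F) → ℂ) y *
        conj (((piProdSB F (Fin n) Ψ : ↥(SchwartzBruhat (Fin n → FiniteAdeleRing (𝓞 F) F))) :
          (Fin n → FiniteAdeleRing (𝓞 F) F) → ℂ) y) ∂μ) * w b) μf := by
  -- the Haar constant of `μ` on the integral box
  have hcμ : 0 < (μ (offBox (ι := Fin n) ∅)).toReal :=
    ENNReal.toReal_pos (measure_offBox_empty_pos F (Fin n) μ).ne' (measure_offBox_empty_lt_top F (Fin n) μ).ne
  -- (F2): the integrand is a pure tensor with factors `fl' = update fl i₀ (μ(𝒪̂ⁿ) • fl i₀)`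
  have hpure : ∀ S : Finset (HeightOneSpectrum (𝓞 F)), T ⊆ S →
      ∀ x : ((v : ↥S) → localPi E c 1 J₁ v) × ((v : {v // v ∉ S}) → (localInt E c 1 J₁ v : Set (localPi E c 1 J₁ v))),
        (fun b : finAdelic F E c 1 J₁ =>
          (∫ y, ((ωfin b (piProdSB F (Fin n) Φ) : ↥(SchwartzBruhat (Fin n → FiniteAdeleRing (𝓞 F) F))) :
              (Fin n → FiniteAdeleRing (𝓞 F) F) → ℂ) y *
            conj (((piProdSB F (Fin n) Ψ : ↥(SchwartzBruhat (Fin n → FiniteAdeleRing (𝓞 F) F))) :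
              (Fin n → FiniteAdeleRing (𝓞 F) F) → ℂ) y) ∂μ) * w b)
          ((finAdelicEquiv F E c 1 J₁).symm (glue (fun v => (localInt E c 1 J₁ v : Set (localPi E c 1 J₁ v))) S x)) =
        ∏ v : ↥S, Function.update fl i₀ (fun g => (μ (offBox (ι := Fin n) ∅)).toReal • fl i₀ g) v.1 (x.1 v) := by
    intro S hS x
    subst hfl_def
    exact finCoeff_isPureTensor_of_Omega_line F E c N e JV J₁ hJ₁ hcδ hδ hd Tb hTb hJb 𝓢 ωfin hωΩ w T hw hρT μ ν Φ Ψ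
      hΦ hΨ hi₀T S hS x
  -- continuity ⇒ measurability
  have hfm : AEStronglyMeasurable (fun b : finAdelic F E c 1 J₁ =>
      (∫ y, ((ωfin b (piProdSB F (Fin n) Φ) : ↥(SchwartzBruhat (Fin n → FiniteAdeleRing (𝓞 F) F))) :
          (Fin n → FiniteAdeleRing (𝓞 F) F) → ℂ) y *
        conj (((piProdSB F (Fin n) Ψ : ↥(SchwartzBruhat (Fin n → FiniteAdeleRing (𝓞 F) F))) :
          (Fin n → FiniteAdeleRing (𝓞 F) F) → ℂ) y) ∂μ) * w b) μf :=
    (continuous_finCoeff_of_Omega F E c N 1 e JV J₁ hcδ hδ hd Tb hTb hJb 𝓢 ωfin hωΩ w hwc μ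
      (piProdSB F (Fin n) Φ) (piProdSB F (Fin n) Ψ)).aestronglyMeasurable
  -- the rows for the rescaled factors
  have hfl' : ∀ v, Integrable (Function.update fl i₀ (fun g => (μ (offBox (ι := Fin n) ∅)).toReal • fl i₀ g) v) (νW v) := by
    intro v
    by_cases hv : v = i₀
    · subst hv
      rw [Function.update_self]
      exact (hfl v).smul ((μ (offBox (ι := Fin n) ∅)).toReal)
    · rw [Function.update_of_ne hv]
      exact hfl v
  have hB' : ∃ B : ℝ, ∀ S : Finset (HeightOneSpectrum (𝓞 F)), S₀ ⊆ S → T ⊆ S →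
      ∏ v ∈ S, ∫ x, ‖Function.update fl i₀ (fun g => (μ (offBox (ι := Fin n) ∅)).toReal • fl i₀ g) v x‖ ∂νW v ≤ B := by
    obtain ⟨B, hB⟩ := hB
    refine ⟨(μ (offBox (ι := Fin n) ∅)).toReal * B, fun S hS₀ hTS => ?_⟩
    have hi : i₀ ∈ S := hTS hi₀T
    have herase : ∏ v ∈ S.erase i₀,
        ∫ x, ‖Function.update fl i₀ (fun g => (μ (offBox (ι := Fin n) ∅)).toReal • fl i₀ g) v x‖ ∂νW v =
          ∏ v ∈ S.erase i₀, ∫ x, ‖fl v x‖ ∂νW v :=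
      Finset.prod_congr rfl fun v hv => by rw [Function.update_of_ne (Finset.ne_of_mem_erase hv)]
    rw [← Finset.mul_prod_erase S _ hi, herase, Function.update_self]
    simp only [norm_smul, Real.norm_eq_abs, abs_of_pos hcμ, integral_const_mul]
    rw [mul_assoc, Finset.mul_prod_erase S (fun v => ∫ x, ‖fl v x‖ ∂νW v) hi]
    exact mul_le_mul_of_nonneg_left (hB S hS₀ hTS) hcμ.le
  exact integrable_finAdelic_of_pureTensor F E c 1 J₁ μf νW S₀ hi₀ hB1 hpure hfm hfl' hB'

include hωΩ hwc hw hρT hΦ hΨ hi₀ hi₀T hB1 hfl_def in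
/-- … hence `b ↦ ‖(∫ (ωfin(b)Φ_f) conj(Ψ_f) dμ) · w(b)‖` is integrable (the shape of the `hF` binder of the orbital-sums reduction).
[cite: Li1992, Thm 2.1 (27) p. 184] [cite: TateThesis1967, Thm 3.3.1] -/
theorem integrable_norm_finCoeff_of_localFactors
    (hfl : ∀ v, Integrable (fl v) (νW v))
    (hB : ∃ B : ℝ, ∀ S : Finset (HeightOneSpectrum (𝓞 F)), S₀ ⊆ S → T ⊆ S →
      ∏ v ∈ S, ∫ x, ‖fl v x‖ ∂νW v ≤ B) :
    Integrable (fun b : finAdelic F E c 1 J₁ =>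
      ‖(∫ y, ((ωfin b (piProdSB F (Fin n) Φ) : ↥(SchwartzBruhat (Fin n → FiniteAdeleRing (𝓞 F) F))) :
          (Fin n → FiniteAdeleRing (𝓞 F) F) → ℂ) y *
        conj (((piProdSB F (Fin n) Ψ : ↥(SchwartzBruhat (Fin n → FiniteAdeleRing (𝓞 F) F))) :
          (Fin n → FiniteAdeleRing (𝓞 F) F) → ℂ) y) ∂μ) * w b‖) μf :=
  (integrable_finCoeff_of_localFactors F E c N e JV J₁ hJ₁ hcδ hδ hd Tb hTb hJb 𝓢 ωfin hωΩ w hwc T hw hρT μ ν Φ Ψ hΦ hΨ μf νW S₀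
    hi₀ hi₀T hB1 fl hfl_def hfl hB).norm

end Line

/-! ## §2 The rows discharged: arbitrary pure tensors, then all of `𝒮(𝔸_{F,f}ⁿ)` -/

section PureTensor

variable (F E : Type) [Field F] [NumberField F] [Field E] [NumberField E] [Algebra F E]
  [Algebra.IsQuadraticExtension F E] (c : E ≃ₐ[F] E) (N : ℕ) {n : ℕ} (e : Fin N × Fin 1 ≃ Fin n)
  (JV : Matrix (Fin N) (Fin N) E) (J₁ : Matrix (Fin 1) (Fin 1) E) (hJ₁ : J₁ 0 0 ≠ 0)
  {δ : E} (hcδ : c δ = -δ) (hδ : δ ≠ 0) {d : F} (hd : δ * δ = algebraMap F E d)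
  (Tb : Matrix (Fin n) (Fin n) F) (hTb : Tb.IsSymm) (hJb : Matrix.reindex e e (JV ⊗ₖ J₁) = Tb.map (algebraMap F E))
  (𝓢 : FinLocalSplittings F E c n hcδ hδ hd Tb hTb hJb) (hTd : IsUnit Tb.det) (h3 : 3 ≤ n) (hJ₁c : (J₁.map c)ᵀ = J₁)
  [MeasurableSpace (FiniteAdeleRing (𝓞 F) F)] [BorelSpace (FiniteAdeleRing (𝓞 F) F)]
  [∀ v : HeightOneSpectrum (𝓞 F), MeasurableSpace (v.adicCompletion F)]
  [∀ v : HeightOneSpectrum (𝓞 F), BorelSpace (v.adicCompletion F)]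
  (μ' : ∀ v : HeightOneSpectrum (𝓞 F), Measure (v.adicCompletion F)) [∀ v, (μ' v).IsAddHaarMeasure]
  (hL2 : ∀ v : HeightOneSpectrum (𝓞 F), (𝓢.omegaLoc v).IsL2Isometric (Measure.pi fun _ : Fin n => μ' v))
  (μ : Measure (Fin n → FiniteAdeleRing (𝓞 F) F)) [μ.IsAddHaarMeasure]
  [∀ v : HeightOneSpectrum (𝓞 F), MeasurableSpace (localPi E c 1 J₁ v)]
  [∀ v : HeightOneSpectrum (𝓞 F), BorelSpace (localPi E c 1 J₁ v)]
  [MeasurableSpace (finAdelic F E c 1 J₁)] [BorelSpace (finAdelic F E c 1 J₁)]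
  (μf : Measure (finAdelic F E c 1 J₁)) [μf.IsHaarMeasure]
  (νW : ∀ v : HeightOneSpectrum (𝓞 F), Measure (localPi E c 1 J₁ v)) [∀ v, (νW v).IsHaarMeasure] [∀ v, SigmaFinite (νW v)]
  (S₀ : Finset (HeightOneSpectrum (𝓞 F))) {i₀ : HeightOneSpectrum (𝓞 F)} (hi₀ : i₀ ∈ S₀)
  (hB1 : ∀ v, v ∉ S₀ → νW v (localInt E c 1 J₁ v : Set (localPi E c 1 J₁ v)) = 1)
  (Φ Ψ : LocalSBFamily F (Fin n))

include hTd h3 hJ₁c hL2 hi₀ hB1 in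
/-- **(FIN-INTEGRABLE), `χ₁`-weighted, for ARBITRARY pure tensors.**  With `𝓢`, `μ'`, `μ`, `μ_f`, `ν^W`, `S₀ ∋ i₀` as in the section header
(`n ≥ 3`), a continuous unitary character `χ₁` of `E¹(𝔸_{F,f})`, and ANY two restricted families `Φ, Ψ` of local Schwartz–Bruhat functions (`Φ_v = Ψ_v = 1_{𝒪_vⁿ}` off a finite set):
`b ↦ (∫ (Ω(1 ⊗ b)(⊗Φ_v))(y) \overline{(⊗Ψ_v)(y)} dμ(y)) · \overline{χ₁(det⁻¹ b)}` is `μ_f`-INTEGRABLE over `U(J₁)(𝔸_{F,f})` — the Euler product of the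
`L¹` norms of the local factors converges ([Li1992, (27)]; [TateThesis1967, Thm 3.3.1]).
[cite: Li1992, Thm 2.1 (27) p. 184; §5 p. 206] [cite: TateThesis1967, Thm 3.3.1] -/
theorem integrable_finCoeff_mul_conj_chi_of_pureTensor
    {χ₁ : finAdelicOne F E c →* ℂˣ} (hχ₁ : Continuous χ₁) (hχ₁u : ∀ x, ‖((χ₁ x : ℂˣ) : ℂ)‖ = 1) :
    Integrable (fun b : finAdelic F E c 1 J₁ =>
      (∫ y, ((𝓢.Omega (finPairEmb F E c N 1 e JV J₁ (1, b)) (piProdSB F (Fin n) Φ) :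
            ↥(SchwartzBruhat (Fin n → FiniteAdeleRing (𝓞 F) F))) : (Fin n → FiniteAdeleRing (𝓞 F) F) → ℂ) y *
          conj (((piProdSB F (Fin n) Ψ : ↥(SchwartzBruhat (Fin n → FiniteAdeleRing (𝓞 F) F))) :
            (Fin n → FiniteAdeleRing (𝓞 F) F) → ℂ) y) ∂μ) *
        conj (((χ₁ (finAdelicCenterInv F E c J₁ hJ₁ b) : ℂˣ) : ℂ))) μf := by
  classical
  -- the level of the two restricted families: `Φ_v = Ψ_v = 1_{𝒪_vⁿ}` off a finite `T`
  obtain ⟨T, hΦ, hΨ⟩ : ∃ T : Finset (HeightOneSpectrum (𝓞 F)),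
      (∀ v, v ∉ T → Φ v = unitVec F (Fin n) v) ∧ (∀ v, v ∉ T → Ψ v = unitVec F (Fin n) v) := by
    have hev := (RestrictedFamily.eventually_eq Φ).and (RestrictedFamily.eventually_eq Ψ)
    rw [Filter.eventually_cofinite] at hev
    exact ⟨hev.toFinset, fun v hv => (not_not.1 fun h => hv (hev.mem_toFinset.2 h)).1,
      fun v hv => (not_not.1 fun h => hv (hev.mem_toFinset.2 h)).2⟩
  -- the weight `w = conj ∘ χ₁ ∘ det⁻¹` as a multiplicative map, continuous and unitary
  let ψ : finAdelic F E c 1 J₁ →* ℂˣ := χ₁.comp (finAdelicCenterInv F E c J₁ hJ₁)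
  let w : finAdelic F E c 1 J₁ →* ℂ := ((starRingEnd ℂ).toMonoidHom.comp (Units.coeHom ℂ)).comp ψ
  have hw_apply : ∀ b, w b = conj (((χ₁ (finAdelicCenterInv F E c J₁ hJ₁ b) : ℂˣ) : ℂ)) := fun _ => rfl
  have hψc : Continuous fun b => ((ψ b : ℂˣ) : ℂ) :=
    Units.continuous_val.comp (hχ₁.comp (continuous_finAdelicCenterInv F E c J₁ hJ₁))
  have hψu : ∀ b, ‖((ψ b : ℂˣ) : ℂ)‖ = 1 := fun b => hχ₁u _
  have hwc : Continuous w := Complex.continuous_conj.comp hψc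
  obtain ⟨Tw, hTw⟩ := exists_forall_boxSubgroup_eq_one F E c 1 J₁ ψ hψc hψu
  -- the unramified clause of `𝓢`: `1_{𝒪_vⁿ}` is fixed by `U(J)(𝒪_v)` off a finite set
  obtain ⟨Tρ, hTρ⟩ : ∃ Tρ : Finset (HeightOneSpectrum (𝓞 F)), ∀ v, v ∉ Tρ →
      unitVec F (Fin n) v ∈ (𝓢.omegaLoc v).fixedPoints (localInt E c n (Matrix.reindex e e (JV ⊗ₖ J₁)) v) := by
    have hu := 𝓢.unramified
    rw [Filter.eventually_cofinite] at hu
    refine ⟨hu.toFinset, fun v hv => ?_⟩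
    have hv' := not_not.1 fun h => hv (hu.mem_toFinset.2 h)
    exact ((𝓢.omegaLoc v).mem_fixedPoints _ _).2 fun k hk => hv' k hk
  -- ONE level `Tf ⊇ T ∪ Tw ∪ Tρ ∪ S₀`
  let Tf : Finset (HeightOneSpectrum (𝓞 F)) := (T ∪ S₀) ∪ (Tw ∪ Tρ)
  have hTT : T ⊆ Tf := fun v hv => Finset.mem_union_left _ (Finset.mem_union_left _ hv)
  have hS₀ : S₀ ⊆ Tf := fun v hv => Finset.mem_union_left _ (Finset.mem_union_right _ hv)
  have hTw' : Tw ⊆ Tf := fun v hv => Finset.mem_union_right _ (Finset.mem_union_left _ hv)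
  have hTρ' : Tρ ⊆ Tf := fun v hv => Finset.mem_union_right _ (Finset.mem_union_right _ hv)
  -- the two `L¹` rows for ARBITRARY pure tensors (the local component of `w` at `v` is `conj χ_{1,v}`, by `rfl`)
  obtain ⟨hfl, ⟨B, hB⟩, -⟩ := 𝓢.localFactor_rows_of_pureTensor J₁ hJ₁ hTd h3 hJ₁c hχ₁ hχ₁u μ' hL2 νW S₀ hB1 T Φ Ψ hΦ hΨ
    (fun (v : HeightOneSpectrum (𝓞 F)) (g : localPi E c 1 J₁ v) =>
      (((Measure.pi fun _ : Fin n => μ' v) (integralBox F (Fin n) v)).toReal⁻¹ •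
        ∫ z, ((𝓢.omegaLoc v (localCenter E c n (Matrix.reindex e e (JV ⊗ₖ J₁)) J₁ hJ₁ v g) (Φ v) :
            ↥(SchwartzBruhat (Fin n → v.adicCompletion F))) : (Fin n → v.adicCompletion F) → ℂ) z *
          conj (((Ψ v : ↥(SchwartzBruhat (Fin n → v.adicCompletion F))) :
            (Fin n → v.adicCompletion F) → ℂ) z) ∂(Measure.pi fun _ : Fin n => μ' v)) *
        w ((finAdelicEquiv F E c 1 J₁).symm (RestrictedProduct.mulSingle (fun v => localInt E c 1 J₁ v) v g))) (by
    funext v g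
    rfl)
  haveI : ∀ v : HeightOneSpectrum (𝓞 F), (Measure.pi fun _ : Fin n => μ' v).IsAddHaarMeasure := fun v => by
    haveI : SecondCountableTopology (v.adicCompletion F) := secondCountableTopology_localField _
    infer_instance
  have hwT : ∀ k ∈ RestrictedProduct.boxSubgroup (fun v => localInt E c 1 J₁ v) Tf, w ((finAdelicEquiv F E c 1 J₁).symm k) = 1 := by
    intro k hk
    have h1 := hTw k (boxSubgroup_antitone (fun v => localInt E c 1 J₁ v) hTw' hk)
    change conj (((ψ ((finAdelicEquiv F E c 1 J₁).symm k) : ℂˣ) : ℂ)) = 1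
    rw [h1, Units.val_one, map_one]
  have key := integrable_finCoeff_of_localFactors F E c N e JV J₁ hJ₁ hcδ hδ hd Tb hTb hJb 𝓢
    (fun u f => 𝓢.Omega (finPairEmb F E c N 1 e JV J₁ (1, u)) f) (fun _ _ => rfl) w hwc Tf hwT
    (fun v hv => hTρ v fun h => hv (hTρ' h)) μ (fun v => Measure.pi fun _ : Fin n => μ' v) Φ Ψ
    (fun v hv => hΦ v fun h => hv (hTT h)) (fun v hv => hΨ v fun h => hv (hTT h)) μf νW S₀ hi₀ (hS₀ hi₀) hB1
    _ rfl hfl ⟨B, fun S _ _ => hB S⟩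
  simpa only [hw_apply] using key

include hJ₁ hTd h3 hJ₁c hL2 hi₀ hB1 in
/-- **(FIN-INTEGRABLE) for ARBITRARY pure tensors** (`χ₁ = 1`): `b ↦ ∫ (Ω(1 ⊗ b)(⊗Φ_v))(y) \overline{(⊗Ψ_v)(y)} dμ(y)` is `μ_f`-INTEGRABLE over
`U(J₁)(𝔸_{F,f})` — the `hF` row of the orbital-sums reduction for pure tensors. [cite: Li1992, Thm 2.1 (27) p. 184; §5 p. 206]
[cite: TateThesis1967, Thm 3.3.1] -/
theorem integrable_finCoeff_of_pureTensor :
    Integrable (fun b : finAdelic F E c 1 J₁ =>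
      ∫ y, ((𝓢.Omega (finPairEmb F E c N 1 e JV J₁ (1, b)) (piProdSB F (Fin n) Φ) :
            ↥(SchwartzBruhat (Fin n → FiniteAdeleRing (𝓞 F) F))) : (Fin n → FiniteAdeleRing (𝓞 F) F) → ℂ) y *
          conj (((piProdSB F (Fin n) Ψ : ↥(SchwartzBruhat (Fin n → FiniteAdeleRing (𝓞 F) F))) :
            (Fin n → FiniteAdeleRing (𝓞 F) F) → ℂ) y) ∂μ) μf := by
  have h1c : Continuous (1 : finAdelicOne F E c →* ℂˣ) := continuous_const
  have h1u : ∀ x, ‖(((1 : finAdelicOne F E c →* ℂˣ) x : ℂˣ) : ℂ)‖ = 1 := fun x => by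
    rw [MonoidHom.one_apply, Units.val_one, norm_one]
  have key := integrable_finCoeff_mul_conj_chi_of_pureTensor F E c N e JV J₁ hJ₁ hcδ hδ hd Tb hTb hJb 𝓢 hTd h3 hJ₁c μ' hL2 μ μf νW
    S₀ hi₀ hB1 Φ Ψ h1c h1u
  simpa only [MonoidHom.one_apply, Units.val_one, map_one, mul_one] using key

include hJ₁ hTd h3 hJ₁c hL2 hi₀ hB1 in
/-- … and its `‖·‖` spelling. [cite: Li1992, Thm 2.1 (27) p. 184] [cite: TateThesis1967, Thm 3.3.1] -/
theorem integrable_norm_finCoeff_of_pureTensor :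
    Integrable (fun b : finAdelic F E c 1 J₁ =>
      ‖∫ y, ((𝓢.Omega (finPairEmb F E c N 1 e JV J₁ (1, b)) (piProdSB F (Fin n) Φ) :
            ↥(SchwartzBruhat (Fin n → FiniteAdeleRing (𝓞 F) F))) : (Fin n → FiniteAdeleRing (𝓞 F) F) → ℂ) y *
          conj (((piProdSB F (Fin n) Ψ : ↥(SchwartzBruhat (Fin n → FiniteAdeleRing (𝓞 F) F))) :
            (Fin n → FiniteAdeleRing (𝓞 F) F) → ℂ) y) ∂μ‖) μf :=
  (integrable_finCoeff_of_pureTensor F E c N e JV J₁ hJ₁ hcδ hδ hd Tb hTb hJb 𝓢 hTd h3 hJ₁c μ' hL2 μ μf νW S₀ hi₀ hB1 Φ Ψ).norm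

include hJ₁ hTd h3 hJ₁c hL2 hi₀ hB1 in
/-- **(FIN-INTEGRABLE) FOR ALL `Φ_f, Ψ_f ∈ 𝒮(𝔸_{F,f}ⁿ)`** — the `hF` row of the orbital-sums reduction for the place-assembled Weil representation
`Ω = ⊗'_v ω_v` of `𝓢`: `b ↦ ∫ (Ω(1 ⊗ b)Φ_f)(y) \overline{Ψ_f(y)} dμ(y)` is `μ_f`-INTEGRABLE over `U(J₁)(𝔸_{F,f})` for EVERY `Φ_f, Ψ_f` (the pure
tensors `⊗_v Φ_v` span `𝒮(𝔸_{F,f}ⁿ)`, ★ `span_range_piProdSB`; the coefficient is sesquilinear, ★ `SchwartzBruhat.integrable_coeff_of_span`;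
pure tensors by `integrable_finCoeff_of_pureTensor`).  «The general case follows from the factorizable one by linearity» ([Li1992, Thm 2.1]).
[cite: Li1992, Thm 2.1 (26)–(27) p. 184; §5 p. 206] [cite: TateThesis1967, Thm 3.3.1] -/
theorem integrable_finCoeff_of_localSplittings (Φf Ψf : ↥(SchwartzBruhat (Fin n → FiniteAdeleRing (𝓞 F) F))) :
    Integrable (fun b : finAdelic F E c 1 J₁ =>
      ∫ y, ((𝓢.Omega (finPairEmb F E c N 1 e JV J₁ (1, b)) Φf :
            ↥(SchwartzBruhat (Fin n → FiniteAdeleRing (𝓞 F) F))) : (Fin n → FiniteAdeleRing (𝓞 F) F) → ℂ) y *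
          conj (((Ψf : ↥(SchwartzBruhat (Fin n → FiniteAdeleRing (𝓞 F) F))) :
            (Fin n → FiniteAdeleRing (𝓞 F) F) → ℂ) y) ∂μ) μf := by
  haveI := secondCountableTopology_finiteAdeleRing F
  haveI : BorelSpace (Fin n → FiniteAdeleRing (𝓞 F) F) := Pi.borelSpace
  refine SchwartzBruhat.integrable_coeff_of_span μ μf (fun b : finAdelic F E c 1 J₁ => 𝓢.Omega (finPairEmb F E c N 1 e JV J₁ (1, b)))
    (Set.range (piProdSB F (Fin n))) (span_range_piProdSB (K := F) (ι := Fin n)) ?_ Φf Ψf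
  rintro _ ⟨Φv, rfl⟩ _ ⟨Ψv, rfl⟩
  exact integrable_finCoeff_of_pureTensor F E c N e JV J₁ hJ₁ hcδ hδ hd Tb hTb hJb 𝓢 hTd h3 hJ₁c μ' hL2 μ μf νW S₀ hi₀ hB1 Φv Ψv

include hJ₁ hTd h3 hJ₁c hL2 hi₀ hB1 in
/-- … and its `‖·‖` spelling, for all `Φ_f, Ψ_f ∈ 𝒮(𝔸_{F,f}ⁿ)`. [cite: Li1992, Thm 2.1 (27) p. 184] [cite: TateThesis1967, Thm 3.3.1] -/
theorem integrable_norm_finCoeff_of_localSplittings (Φf Ψf : ↥(SchwartzBruhat (Fin n → FiniteAdeleRing (𝓞 F) F))) :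
    Integrable (fun b : finAdelic F E c 1 J₁ =>
      ‖∫ y, ((𝓢.Omega (finPairEmb F E c N 1 e JV J₁ (1, b)) Φf :
            ↥(SchwartzBruhat (Fin n → FiniteAdeleRing (𝓞 F) F))) : (Fin n → FiniteAdeleRing (𝓞 F) F) → ℂ) y *
          conj (((Ψf : ↥(SchwartzBruhat (Fin n → FiniteAdeleRing (𝓞 F) F))) :
            (Fin n → FiniteAdeleRing (𝓞 F) F) → ℂ) y) ∂μ‖) μf :=
  (integrable_finCoeff_of_localSplittings F E c N e JV J₁ hJ₁ hcδ hδ hd Tb hTb hJb 𝓢 hTd h3 hJ₁c μ' hL2 μ μf νW S₀ hi₀ hB1 Φf Ψf).norm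

end PureTensor

end Summit.HodgeConjecture.HodgeConjecture.Cruxes.H413.ThetaNonvanishing

end
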